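import Literature.MathematicalPhysics.QuantumFieldTheory.Balaban1985CMP102.Setting
import Summits.QuantumFields.Balaban3D.Carriers.RTSelect

/-!
# Lane `pub-balaban3d` — carrier layer p1, part 3 (`Carriers.Run`): the run objects of [Balaban1985UV3] pp. 256–257 INHABITED —
# `run3` fills the spine's binder record `…Balaban1985CMP102.Setting.RunObjects` with the CONSTRUCTED renormalization
# transformation `T = rtOpIOfAC` (D-1a), and proves (2) `ρ_{k+1} = Tρ_k` (rfl) and **(6)** `Setting.RunObjects.Eq6 (run3 …)`

Source: T. Bałaban, CMP **102** (1985) 255–275 [Balaban1985UV3], (1)–(2) p. 256, (6) p. 257 (renders `…-p002/p003-x2.png`).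
Lead rulings R-D1 / R-EQ6 (lane STATUS 2026-08-21T23:54:58Z): (6) is CLAIMED only for the constructed run — an abstract binder
`T : RTOpI` does not make `Tρ` integrable for `k ≥ 2` (seat finding F-p1-1).  The objects this file does NOT construct remain
the binders of the input record `RunInput` (the vacuum-energy constant `E` of (1) — R-E: `B10.Ek` of the expansion's profile —,
the thresholds `ε₁` of (4)/(7), the averaging family `Ū` of [4] with its absolute-continuity certificate `AvgAC` (D-1a; discharged
for the axial family by `Carriers.RT.avgAC_stdAvg`), the regular classes and minimizers `U_k` of [7] = [Balaban1985Variational]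
Thm 1 (binder b11), and the (41)/(47) slot, which the spine's Sect. B pins to `B10.Ineq41 ∧ B10.Ineq47`).
HONEST FRAMING (PLAN §0): no statement of CMP 102 is claimed; (6) is a theorem of measure theory about the constructed `T`.
-/

open MeasureTheory

namespace Summit.QuantumFields.Balaban3D.Carriers

open Literature.MathematicalPhysics.QuantumFieldTheory.Balaban1983to89
open Literature.MathematicalPhysics.QuantumFieldTheory.Balaban1985CMP102.Setting

/-! ## §1 The input record: what the carrier seat takes as given -/

/-- THE BINDERS OF ONE RUN that this layer does not construct (see the module docstring): `E` (1), `ε₁` (4)/(7), the averaging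
family `Ū` of [4] with `AvgAC` at every level (D-1a), the regular classes `reg` and minimizers `U_k` of [7] for `k ≥ 1` (b11), and
the abstract (41)/(47) slot, and — ruling R-RN — the SANDWICH BARRIERS `lower k ≤ · ≤ upper k` (v1.2: DEFINED by `Carriers.Standard` as the
printed (57)/(55) step bounds; no measurability is asked — the selected version is dV-a.e. the RN transport) inside which the version
of `ρ_{k+1} = Tρ_k` is selected (`Carriers.RT.rtOpISelect`; all versions agree dV-a.e.). [cite: Balaban1985UV3, (1)–(6) pp.256–257] -/
structure RunInput {L : ℕ} (S : Scales L) (G : Type) [GaugeGroup G] [MeasurableSpace G] [HaarData G] where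
  /-- `E` of (1) p. 256 («defined inductively in the course of the proof»: (62) p. 271, (64) p. 273) -/
  E : ℝ
  /-- `ε₁` of (4) p. 256 / (7) p. 257, per step -/
  ε₁ : ℕ → ℝ
  /-- the averaging operation `U ↦ Ū` of [4] (15) p. 19, per level -/
  av : ∀ j, Averaging S.P j G
  /-- D-1a: `Ū` is measurable and `Ū_*(dU) ≪ dV`, per level (lane binder «AvgPushforwardAC») -/
  avgAC : ∀ j, AvgAC (av j).avg
  /-- the regular classes of [7] (2), (6), (8) pp. 278–279, per step -/
  reg : ℕ → Set (GaugeField S.P 0 G)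
  /-- the minimizers `U_k(V)` of [7] Thm 1 p. 279 for `k ≥ 1` (`U_0(U) = U`: unit lattices, p. 256 L12–13) -/
  Uk : (k : ℕ) → GaugeField S.P (k + 1) G → GaugeField S.P 0 G
  /-- «ρ_k satisfies (41), (47)» — the abstract slot of `B10.RunData`, pinned by the spine's Sect. B -/
  ineq41_47 : ℕ → Prop
  /-- R-RN lower barrier of the step `k → k+1`: the right-hand side of the printed LOWER step bound ((37) p. 265 / (47) p. 267 /
  (57)) for this run, an explicit function of the coarse field (default choice when no sandwich is wanted: `0`) -/
  lower : (k : ℕ) → Density S.P (k + 1) G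
  /-- R-RN upper barrier: the right-hand side of the printed UPPER step bound ((36) p. 265 / (41) p. 266 / (55)) -/
  upper : (k : ℕ) → Density S.P (k + 1) G
  /-- the lower barrier is non-negative (it is `χ · exp(…)`) -/
  lower_nonneg : ∀ k V, 0 ≤ lower k V
  /-- the upper barrier is non-negative (it is a value of the positive functional `LF`) -/
  upper_nonneg : ∀ k V, 0 ≤ upper k V

namespace RunInput

variable {L : ℕ} {S : Scales L} {G : Type} [GaugeGroup G] [MeasurableSpace G] [HaarData G] (I : RunInput S G)

/-- `U_k(V)` for all `k`, with `U_0 = id` (the configuration itself on the finest lattice; lead ruling R-K0). [folklore] -/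
def UkAll : (k : ℕ) → GaugeField S.P k G → GaugeField S.P 0 G
  | 0 => id
  | k + 1 => I.Uk k

/-- `U_0(U) = U` (definitional). [folklore] -/
theorem UkAll_zero (U : GaugeField S.P 0 G) : I.UkAll 0 U = U := rfl

end RunInput

/-! ## §2 `run3`: the spine's `RunObjects` with the constructed `T` -/

section Run3

variable {L : ℕ} {S : Scales L} {G : Type} [GaugeGroup G] [MeasurableSpace G] [HaarData G]

/-- **THE RUN OBJECTS INHABITED**: `Setting.RunObjects S G` with `T j := rtOpISelect (av j) …` — the Radon–Nikodym renormalization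
transformation of D-1a ([Balaban1985Averaging] (10) in the push-forward reading), version re-selected inside the step sandwich
⟦reading R-RN: version selection; all versions agree dV-a.e., `run3_rho_succ_ae_eq_rn`⟧ — over the input binders. [cite: Balaban1985UV3, (1)–(6) pp.256–257] -/
noncomputable def run3 (I : RunInput S G) : RunObjects S G where
  E := I.E
  ε₁ := I.ε₁
  av := I.av
  T := fun j => rtOpISelect (I.av j) (I.avgAC j) (I.lower j) (I.upper j) (I.upper_nonneg j)
  reg := I.reg
  Uk := I.UkAll
  ineq41_47 := I.ineq41_47

variable (I : RunInput S G)

/-- `run3`'s transformation is the selected RN transport (unfolding lemma). [folklore] -/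
theorem run3_T_apply (j : ℕ) (ρ : Density S.P j G) :
    ((run3 I).T j).T ρ = selectVersion (I.lower j) (I.upper j) (AveragingRT.rnTransport (I.av j).avg ρ) := rfl

/-- **(2)** p. 256 L11 «ρ_{k+1} = Tρ_k» for `run3` — definitional (the spine DEFINES `rho` by this recursion). [cite: Balaban1985UV3, (2) p.256] -/
theorem run3_rho_succ (k : ℕ) : (run3 I).rho (k + 1) = ((run3 I).T k).T ((run3 I).rho k) := rfl

/-- **(1)** p. 256: `run3`'s `ρ₀` is the Wilson start `exp[−(1/g₀²)A(U) − E]` of `Carriers.RT` with `g₀² = g²ε` — definitional.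
[cite: Balaban1985UV3, (1) p.256] -/
theorem run3_rho0 : (run3 I).rho0 = wilsonStart S.P G S.g0sq I.E := rfl

/-- `ρ_0 = ρ₀` — definitional. [folklore] -/
theorem run3_rho_zero : (run3 I).rho 0 = wilsonStart S.P G S.g0sq I.E := rfl

/-- HONESTY (R-RN): `ρ_{k+1}` is dV-a.e. EQUAL to the plain RN transport of `ρ_k` — no bound is selected into existence. [folklore] -/
theorem run3_rho_succ_ae_eq_rn (k : ℕ) :
    (run3 I).rho (k + 1) =ᵐ[fieldMeasure S.P (k + 1) G] AveragingRT.rnTransport (I.av k).avg ((run3 I).rho k) := by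
  rw [run3_rho_succ]
  exact rtOpISelect_ae_eq_rn (I.av k) (I.avgAC k) (I.lower k) (I.upper k) (I.upper_nonneg k) _

/-- **ONE-SIDED SELECTION PROPERTY, upper half** (rulings R-RN «select_spec» / R-SEL (a); seat p4's `hsel` of `bound55_of_select`): if the RN transport of `ρ_k`
lies below `upper k` dV-a.e. and `lower k ≤ upper k` pointwise, then `ρ_{k+1} ≤ upper k` EVERYWHERE. [folklore] -/
theorem run3_rho_succ_le_upper (k : ℕ)
    (hup : ∀ᵐ V ∂(fieldMeasure S.P (k + 1) G), AveragingRT.rnTransport (I.av k).avg ((run3 I).rho k) V ≤ I.upper k V)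
    (hlu : ∀ V, I.lower k V ≤ I.upper k V) (V : GaugeField S.P (k + 1) G) : (run3 I).rho (k + 1) V ≤ I.upper k V := by
  rw [run3_rho_succ]
  exact rtOpISelect_le_upper (I.av k) (I.avgAC k) (I.upper_nonneg k) hlu _ hup V

/-- **ONE-SIDED SELECTION PROPERTY, lower half** (rulings R-RN «select_spec» / R-SEL (a); seat p4's `hsel` of `bound55Lower_of_select`): if the RN transport of
`ρ_k` lies above `lower k` dV-a.e., then `lower k ≤ ρ_{k+1}` EVERYWHERE (no hypothesis on the upper barrier). [folklore] -/
theorem run3_lower_le_rho_succ (k : ℕ)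
    (hlo : ∀ᵐ V ∂(fieldMeasure S.P (k + 1) G), I.lower k V ≤ AveragingRT.rnTransport (I.av k).avg ((run3 I).rho k) V)
    (V : GaugeField S.P (k + 1) G) : I.lower k V ≤ (run3 I).rho (k + 1) V := by
  rw [run3_rho_succ]
  exact rtOpISelect_lower_le (I.av k) (I.avgAC k) (I.upper_nonneg k) _ hlo V

/-- Two-sided selection property for the run (ruling R-RN's «select_spec»): both a.e. bounds and `lower k ≤ upper k` give the sandwich EVERYWHERE. [folklore] -/
theorem run3_rho_succ_sandwich (k : ℕ) (hlu : ∀ V, I.lower k V ≤ I.upper k V)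
    (hae : ∀ᵐ V ∂(fieldMeasure S.P (k + 1) G),
      I.lower k V ≤ AveragingRT.rnTransport (I.av k).avg ((run3 I).rho k) V ∧
        AveragingRT.rnTransport (I.av k).avg ((run3 I).rho k) V ≤ I.upper k V)
    (V : GaugeField S.P (k + 1) G) : I.lower k V ≤ (run3 I).rho (k + 1) V ∧ (run3 I).rho (k + 1) V ≤ I.upper k V :=
  ⟨run3_lower_le_rho_succ I k (hae.mono fun _ h => h.1) V, run3_rho_succ_le_upper I k (hae.mono fun _ h => h.2) hlu V⟩

/-- `g₀² = g²ε ≥ 0`. [folklore] -/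
theorem g0sq_nonneg (S : Scales L) : 0 ≤ S.g0sq := by
  unfold Scales.g0sq; have := S.ε_pos; positivity

/-- `ρ_k ≥ 0` pointwise, every `k`. [folklore] -/
theorem run3_rho_nonneg : ∀ (k : ℕ) (V : GaugeField S.P k G), 0 ≤ (run3 I).rho k V
  | 0, V => (wilsonStart_pos _ _ V).le
  | k + 1, V => by rw [run3_rho_succ]; exact ((run3 I).T k).pos _ (run3_rho_nonneg k) V

/-- `ρ_{k+1}` is measurable whenever the barriers of step `k` are (no hypothesis on the group; not needed by the tower — integrability and
the push-forward identity only see the a.e.-class). [folklore] -/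
theorem run3_rho_succ_measurable (k : ℕ) (hl : Measurable (I.lower k)) (hu : Measurable (I.upper k)) :
    Measurable ((run3 I).rho (k + 1)) := by
  rw [run3_rho_succ]
  exact measurable_rtOpISelect (I.av k) (I.avgAC k) (I.upper_nonneg k) hl hu _

variable [RegularGaugeGroup G]

/-- `ρ_k` is integrable for the product Haar measure, every `k`. [folklore] -/
theorem run3_rho_integrable : ∀ k, Integrable ((run3 I).rho k) (fieldMeasure S.P k G)
  | 0 => integrable_wilsonStart (g0sq_nonneg S) _
  | k + 1 => by
    rw [run3_rho_succ]
    exact integrable_rtOpISelect (I.av k) (I.avgAC k) (I.lower k) (I.upper k) (I.upper_nonneg k) _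
      (run3_rho_integrable k)

/-- Each step of `run3` IS a renormalization transform in the push-forward reading: `IsRT Ū_k ρ_k ρ_{k+1}` for every `k`
([Balaban1985Averaging] (10) p. 19). [cite: Balaban1985Averaging, (10) p.19] -/
theorem run3_isRT (k : ℕ) : IsRT (I.av k).avg ((run3 I).rho k) ((run3 I).rho (k + 1)) := by
  rw [run3_rho_succ]; exact ((run3 I).T k).isRT _ (run3_rho_integrable I k)

/-- **(6)** p. 257 = PDF 3 L11–14 «∫dUρ_k = ∫dUT^kρ₀ = ∫dUρ₀ = Z^ε» AS A THEOREM for the constructed run, in the stronger form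
«for every `k`» (print needs `k ≤ K`). [cite: Balaban1985UV3, (6) p.257] -/
theorem run3_integral_rho : ∀ k, ∫ V, (run3 I).rho k V ∂(fieldMeasure S.P k G) = (run3 I).Zeps
  | 0 => rfl
  | k + 1 => by rw [← run3_integral_rho k]; exact integral_eq_of_isRT (run3_isRT I k)

/-- **(6) BY NAME**: the spine's proposition `Setting.RunObjects.Eq6` holds for `run3` (lead ruling R-EQ6: claimed for the
constructed run only). [cite: Balaban1985UV3, (6) p.257] -/
theorem run3_eq6 : (run3 I).Eq6 := fun k _ => run3_integral_rho I k

omit [RegularGaugeGroup G] in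
/-- **HONESTY OF THE VERSION SELECTION ALONG THE WHOLE RUN** (ruling R-RN; the base of the corollary `run3_bounds_ae_rnVersion` below, PLAN §0.4/§0.5): for
EVERY `k`, the run's `ρ_k` is dV-a.e. EQUAL to the PLAIN iterated Radon–Nikodym version `Carriers.rhoSeq` of `T^kρ₀` (no re-selection at all) — the
selections move null sets only, and the RN transport sees only a.e.-classes (`rnTransport_congr_ae`). [folklore] -/
theorem run3_rho_ae_eq_rhoSeq : ∀ k,
    (run3 I).rho k =ᵐ[fieldMeasure S.P k G] rhoSeq I.av (wilsonStart S.P G S.g0sq I.E) k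
  | 0 => Filter.EventuallyEq.rfl
  | k + 1 => by
    refine (run3_rho_succ_ae_eq_rn I k).trans (Filter.EventuallyEq.of_eq ?_)
    rw [rhoSeq_succ]
    exact rnTransport_congr_ae (run3_rho_ae_eq_rhoSeq k) (run3_rho_nonneg I k)
      (rhoSeq_nonneg _ _ (fun U => (wilsonStart_pos _ _ U).le) k)

omit [RegularGaugeGroup G] in
/-- **HONESTY COROLLARY OF SHAPE «bounds5_ae_rnVersion»** (PLAN §0.5's name; ruling R-RN): any two-sided POINTWISE bound proved for the run's `ρ_k` — e.g. the
stability bounds (5) — holds dV-ALMOST EVERYWHERE for the plain iterated RN version `rhoSeq` (seat p3 instantiates `lo`/`hi` with the two sides of (5)).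
[cite: Balaban1985UV3, (5) p.256] -/
theorem run3_bounds_ae_rnVersion (k : ℕ) {lo hi : Density S.P k G}
    (h : ∀ U, lo U ≤ (run3 I).rho k U ∧ (run3 I).rho k U ≤ hi U) :
    ∀ᵐ U ∂(fieldMeasure S.P k G),
      lo U ≤ rhoSeq I.av (wilsonStart S.P G S.g0sq I.E) k U ∧ rhoSeq I.av (wilsonStart S.P G S.g0sq I.E) k U ≤ hi U := by
  filter_upwards [run3_rho_ae_eq_rhoSeq I k] with U hU
  rw [← hU]
  exact h U

end Run3

/-! ## §3 Non-vacuity: an input record exists for every lattice approximation and every regular gauge group -/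

section NonVacuity

variable {L : ℕ} (S : Scales L) (G : Type) [GaugeGroup G] [MeasurableSpace G] [HaarData G] [RegularGaugeGroup G]

/-- The TRIVIAL input over the tree's axial averaging family (`AveragingRT.stdAvg`, `AvgAC` by `avgAC_stdAvg`): `E = 0`, `ε₁ = 1`,
all configurations regular, `U_k :=` any section (here the constant configuration `1`), slot `True`.  Its only purpose is to
certify that `RunInput S G` — hence `RunObjects S G` with a GENUINE renormalization transformation and (6) — is inhabited for every
`S` and every regular `G`; it is NOT print's run (whose `U_k` is [7]'s minimizer and whose `Ū` is [4] (15)). [folklore] -/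
noncomputable def trivialInput : RunInput S G where
  E := 0
  ε₁ := fun _ => 1
  av := AveragingRT.stdAvg S.P G
  avgAC := fun j => avgAC_stdAvg j
  reg := fun _ => Set.univ
  Uk := fun _ _ => 1
  ineq41_47 := fun _ => True
  lower := fun _ _ => 0
  upper := fun _ _ => 0
  lower_nonneg := fun _ _ => le_rfl
  upper_nonneg := fun _ _ => le_rfl

/-- `RunObjects S G` is inhabited by a run satisfying (2) and (6), for every `S` and every regular `G`. [folklore] -/
theorem exists_runObjects_eq6 : ∃ R : RunObjects S G, R.Eq6 := ⟨run3 (trivialInput S G), run3_eq6 _⟩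

end NonVacuity

end Summit.QuantumFields.Balaban3D.Carriers
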